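import Summits.KontsevichZagierPeriods.KontsevichZagierPeriods.Theorems.LinRedNormalFormHoffmanIndependenceSplit
import Mathlib.LinearAlgebra.LinearIndependent.Lemmas

/-!
# Crux `HoffmanIndependence` (stmt-KontsevichZagierPeriods-15045), line `weight_split`:
# the crux is EXACTLY the conjunction of its finite weight truncations

`HoffmanIndependence` — `ℚ`-linear independence of ALL real Hoffman values `ζ(u)`, `u ∈ {2,3}^×` —
holds iff, for every `N`, the Hoffman values of weight `≤ N` are `ℚ`-linearly independent. This is
the crux's own rung ladder (rungs `N ≤ 2` known; `N = 3` is `ζ(3) ∉ ℚ + ℚπ²`, open).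

Pure linear algebra: (→) restrict the independent family along the injection
`{u // IsHoffman u ∧ weight u ≤ N} ↪ {u // IsHoffman u}`; (←) a family is independent iff all its
finite subfamilies are (`linearIndependent_iff_finset_linearIndependent`), and a finset `s` of
Hoffman indices sits inside the truncation at `N := s.sup weight`.
[cite: Zagier1994, §9] [folklore]
-/

noncomputable section

namespace Summit.KontsevichZagierPeriods.LinRedNormalForm.HoffmanIndependence

open Literature.NumberTheory.Transcendental MZV
open Summit.KontsevichZagierPeriods.KontsevichZagierPeriods.Theses.LinRedNormalForm (HoffmanIndependence)

/-- The crux gives every finite weight truncation (restrict the independent family to the indices of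
weight `≤ N`). [folklore] -/
theorem truncation_of_hoffmanIndependence (h : HoffmanIndependence) (N : ℕ) :
    LinearIndependent ℚ
      (fun u : {u : List ℕ // IsHoffman u ∧ weight u ≤ N} => multipleZeta u.1) := by
  have h' : LinearIndependent ℚ (fun u : {u : List ℕ // IsHoffman u} => multipleZeta u.1) := h
  exact h'.comp (fun u : {u : List ℕ // IsHoffman u ∧ weight u ≤ N} =>
      (⟨u.1, u.2.1⟩ : {u : List ℕ // IsHoffman u}))
    fun a b hab => Subtype.ext (by have h := congrArg Subtype.val hab; exact h)

/-- All finite weight truncations together give the crux: a family is linearly independent iff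
every finite subfamily is, and a finite set `s` of Hoffman indices lies in the truncation at
`N := s.sup weight`. [folklore] -/
theorem hoffmanIndependence_of_forall_truncation
    (h : ∀ N : ℕ, LinearIndependent ℚ
      (fun u : {u : List ℕ // IsHoffman u ∧ weight u ≤ N} => multipleZeta u.1)) :
    HoffmanIndependence := by
  show LinearIndependent ℚ (fun u : {u : List ℕ // IsHoffman u} => multipleZeta u.1)
  rw [linearIndependent_iff_finset_linearIndependent]
  intro s
  have hle : ∀ u ∈ s, weight u.1 ≤ s.sup (fun u => weight u.1) :=
    fun u hu => Finset.le_sup (f := fun u : {u : List ℕ // IsHoffman u} => weight u.1) hu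
  let e : s → {u : List ℕ // IsHoffman u ∧ weight u ≤ s.sup (fun u => weight u.1)} :=
    fun x => ⟨x.1.1, x.1.2, hle x.1 x.2⟩
  have he : Function.Injective e := fun a b hab =>
    Subtype.ext (Subtype.ext (by have h := congrArg Subtype.val hab; exact h))
  exact (h _).comp e he

/-- **The crux is exactly the conjunction of its finite weight truncations**:
`HoffmanIndependence ⟺ ∀ N, the real Hoffman values of weight ≤ N are ℚ-linearly independent`.
The rung ladder of the crux: `N ≤ 2` is known, `N = 3` is `ζ(3) ∉ ℚ + ℚπ²` (open).
[cite: Zagier1994, §9] [folklore] -/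
theorem hoffmanIndependence_iff_forall_truncation : HoffmanIndependence ↔ ∀ N : ℕ, LinearIndependent ℚ (fun u : {u : List ℕ // IsHoffman u ∧ weight u ≤ N} => multipleZeta u.1) :=
  ⟨truncation_of_hoffmanIndependence, hoffmanIndependence_of_forall_truncation⟩

end Summit.KontsevichZagierPeriods.LinRedNormalForm.HoffmanIndependence
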